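import Literature.Probability.Percolation.KSTPeriodicStatements
import Literature.Probability.Percolation.ZdCrossingTranspose
import HarnessLib

/-!
# KST-type RSW for periodic measures: the corridor lemma (Lemma 2)

Topic `Literature/Probability/Percolation`. Discrete proof of [KohlerSchindlerTassion2023, Lemma 2
and Remark 1] in the two orientations `CorridorA` (horizontal crosser) and `CorridorB` (vertical
crosser) of `KSTPeriodicStatements.lean`, from the arm duality `ArmDuality`.

* `corridor_faceWalk` (the duality half, orientation-free): if no walk inside the target rectangle
  `H` from the upper to the lower target uses only edges of a given edge set `C`, then the dual
  face path across `H` supplied by `ArmDuality` for `C ∩ E(H)` — trimmed to run through inside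
  faces — crosses a primal edge outside `C` at every step, and it must cross an edge of every wall
  (a walk inside `H` from the upper to the lower target; `ArmDuality` again); we return the face
  walk between two such crossings, whose end faces are labelled by wall vertices.
* `corridorA_of_armDuality` (winding half): along the chain top row ~ connector ~ wall ~ face walk ~
  wall ~ connector ~ bottom row the winding number of the extended crosser
  (`extendRight`, `walkWinding_eq_of_walk`, `walkWinding_eq_of_faceWalk`) is constant, yet it is
  `0` on the top row and `-1` below the bottom row (`walkWinding_extendRight_top/bottom`).
* `corridorB_of_armDuality`: the same after transposing the configuration.

## References

* [KohlerSchindlerTassion2023] L. Köhler-Schindler, V. Tassion, Duke Math. J. 172 (2023), Lemma 2, Remark 1.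
* [KestenPTM1982] H. Kesten, *Percolation theory for mathematicians* (1982), §2.2 (winding numbers).
-/

namespace Literature.Probability.Percolation

open LatticeModels SimpleGraph

noncomputable section

namespace KSTPeriodic

/-! ### Walk surgery: prefix up to the first vertex with a property -/

/-- A walk ending in a vertex with property `P` has a prefix ending at a `P`-vertex `r` all of
whose other vertices fail `P` (the first visit to `P`). [folklore] -/
theorem exists_prefix_first {V : Type*} {G : SimpleGraph V} (P : V → Prop) {u v : V}
    (w : G.Walk u v) (hv : P v) :
    ∃ (r : V) (w' : G.Walk u r), P r ∧ (∀ z ∈ w'.support, z ∈ w.support) ∧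
      (∀ d ∈ w'.darts, d ∈ w.darts) ∧ ∀ z ∈ w'.support, P z → z = r := by
  induction w with
  | nil => exact ⟨_, Walk.nil, hv, fun z hz => hz, fun d hd => hd, fun z hz _ => by simpa using hz⟩
  | cons h w ih =>
    rename_i x y z'
    by_cases hx : P x
    · exact ⟨x, Walk.nil, hx, fun z hz => by simp_all, fun d hd => by simp at hd,
        fun z hz _ => by simpa using hz⟩
    · obtain ⟨r, w', hr, hs, hd, huniq⟩ := ih hv
      refine ⟨r, Walk.cons h w', hr, ?_, ?_, ?_⟩
      · intro z hz
        rw [Walk.support_cons, List.mem_cons] at hz ⊢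
        exact hz.imp id (hs z)
      · intro d hd'
        rw [Walk.darts_cons, List.mem_cons] at hd' ⊢
        exact hd'.imp id (hd d)
      · intro z hz hPz
        rw [Walk.support_cons, List.mem_cons] at hz
        rcases hz with rfl | hz
        · exact absurd hPz hx
        · exact huniq z hz hPz

/-! ### Sides of faces -/

/-- The primal edge separating two adjacent faces is a side of the first face: both its endpoints
lie in the closed unit square with lower-left corner `f`. [folklore] -/
theorem sepEdge_subset_face {f f' w : Site 2} (h : (zdGraph 2).Adj f f') (hw : w ∈ sepEdge f f') :
    f 0 ≤ w 0 ∧ w 0 ≤ f 0 + 1 ∧ f 1 ≤ w 1 ∧ w 1 ≤ f 1 + 1 := by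
  rcases stepKind_of_adj h with ⟨h0, h1⟩ | ⟨h0, h1⟩ | ⟨h1, h0⟩ | ⟨h1, h0⟩
  · obtain rfl : f' = f + Pi.single 0 1 := by simp [Site.eq_iff_two, h0, h1]
    rw [sepEdge_right, Sym2.mem_iff] at hw
    rcases hw with rfl | rfl <;> simp
  · obtain rfl : f = f' + Pi.single 0 1 := by simp [Site.eq_iff_two, h0, h1]
    rw [sepEdge_comm, sepEdge_right, Sym2.mem_iff] at hw
    rcases hw with rfl | rfl <;> simp
  · obtain rfl : f' = f + Pi.single 1 1 := by simp [Site.eq_iff_two, h0, h1]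
    rw [sepEdge_up, Sym2.mem_iff] at hw
    rcases hw with rfl | rfl <;> simp
  · obtain rfl : f = f' + Pi.single 1 1 := by simp [Site.eq_iff_two, h0, h1]
    rw [sepEdge_comm, sepEdge_up, Sym2.mem_iff] at hw
    rcases hw with rfl | rfl <;> simp

/-- `sepLo f f'` is one of the two faces. [folklore] -/
theorem sepLo_eq_or (f f' : Site 2) (h : (zdGraph 2).Adj f f') : sepLo f f' = f ∨ sepLo f f' = f' := by
  rcases stepKind_of_adj h with ⟨h0, h1⟩ | ⟨h0, h1⟩ | ⟨h1, h0⟩ | ⟨h1, h0⟩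
  · obtain rfl : f' = f + Pi.single 0 1 := by simp [Site.eq_iff_two, h0, h1]
    exact Or.inr (sepLo_add_e0 f)
  · obtain rfl : f = f' + Pi.single 0 1 := by simp [Site.eq_iff_two, h0, h1]
    rw [sepLo_comm]; exact Or.inl (sepLo_add_e0 f')
  · obtain rfl : f' = f + Pi.single 1 1 := by simp [Site.eq_iff_two, h0, h1]
    exact Or.inr (sepLo_add_e1 f)
  · obtain rfl : f = f' + Pi.single 1 1 := by simp [Site.eq_iff_two, h0, h1]
    rw [sepLo_comm]; exact Or.inl (sepLo_add_e1 f')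

/-- `sepLo f f'` is an endpoint of `sepEdge f f'`. [folklore] -/
theorem sepLo_mem_sepEdge (f f' : Site 2) : sepLo f f' ∈ sepEdge f f' := by
  rw [sepEdge]; exact Sym2.mem_mk_left _ _

/-- A vertex of an edge of a walk is a vertex of the walk. [folklore] -/
theorem mem_support_of_mem_edges' {V : Type*} {G : SimpleGraph V} {u v : V} {p : G.Walk u v}
    {e : Sym2 V} (he : e ∈ p.edges) {z : V} (hz : z ∈ e) : z ∈ p.support := by
  have : s(z, Sym2.Mem.other hz) ∈ p.edges := by rw [Sym2.other_spec hz]; exact he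
  exact p.fst_mem_support_of_mem_edges this

/-! ### Dual walks and the edges they cross -/

/-- A dart of a walk with edges in `dualConfig ω` crosses a primal edge outside `ω`. [folklore] -/
theorem sepEdge_notMem_of_dart {ω : BondConfig (Site 2)} {c d : Site 2} {q : (zdGraph 2).Walk c d}
    (hq : ∀ e ∈ q.edges, e ∈ dualConfig ω) {dq : (zdGraph 2).Dart} (hdq : dq ∈ q.darts) :
    sepEdge dq.fst dq.snd ∉ ω := by
  intro hmem
  have he : s(dq.fst, dq.snd) ∈ dualConfig ω := hq _ (by
    rw [Walk.edges]; exact List.mem_map.2 ⟨dq, hdq, rfl⟩)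
  rw [mem_dualConfig_iff] at he
  exact he.2 _ hmem (dualEdge_sepEdge dq.adj)

/-- Conversely, a walk of faces none of whose darts crosses an edge of `ω ⊆ E(ℤ²)` has its edges
in `dualConfig ω`. [folklore] -/
theorem edges_mem_dualConfig_of_forall_sepEdge {ω : BondConfig (Site 2)} {c d : Site 2}
    {q : (zdGraph 2).Walk c d} (h : ∀ dq ∈ q.darts, sepEdge dq.fst dq.snd ∉ ω) :
    ∀ e ∈ q.edges, e ∈ dualConfig ω := by
  intro e he
  rw [Walk.edges, List.mem_map] at he
  obtain ⟨dq, hdq, rfl⟩ := he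
  rw [mem_dualConfig_iff]
  refine ⟨dq.edge_mem, fun e' he' heq => ?_⟩
  have h1 : dualEdge (sepEdge dq.fst dq.snd) = s(dq.fst, dq.snd) := dualEdge_sepEdge dq.adj
  have : e' = sepEdge dq.fst dq.snd := dualEdge_bijective.1 (heq.trans h1.symm)
  exact h dq hdq (this ▸ he')

/-! ### The duality half -/

/-- **Duality half of the corridor lemma.** In the target rectangle `H = [x₁, x₂] × [y₁, y₂]`
(targets `[u₁, u₂]` on its top and bottom rows, `x₁ < u₁ < u₂ < x₂`, `y₁ < y₂`) let `C ⊆ E(ℤ²)` be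
an edge set such that NO walk inside `H` from the upper to the lower target uses only edges of
`C`, and let `γ₁, γ₂` be two walls (walks inside `H` from the upper to the lower target). Then
there is a walk of faces `η` from a face labelled by a vertex of `γ₁` to a face labelled by a
vertex of `γ₂`, every dart of which crosses a primal edge that lies in `H` and outside `C`, all of
whose faces lie in `[x₁ - 1, x₂] × [y₁ - 1, y₂]`. (From `ArmDuality` three times: once for
`C ∩ E(H)` to get a dual path across `H`, trimmed to inside faces, and once per wall to see that
this path crosses it.) [cite: KohlerSchindlerTassion2023, Lemma 2 (via §1 Duality)] -/
theorem corridor_faceWalk (hDu : ArmDuality) {x₁ x₂ y₁ y₂ u₁ u₂ : ℤ} (hxu : x₁ < u₁) (hu : u₁ < u₂)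
    (hux : u₂ < x₂) (hy : y₁ < y₂) {C : Set (Sym2 (Site 2))} (hCE : C ⊆ (zdGraph 2).edgeSet)
    (hC : ¬ ∃ (p q : Site 2) (κ : (zdGraph 2).Walk p q),
      (u₁ ≤ p 0 ∧ p 0 ≤ u₂ ∧ p 1 = y₂) ∧ (u₁ ≤ q 0 ∧ q 0 ≤ u₂ ∧ q 1 = y₁) ∧
      (∀ z ∈ κ.support, x₁ ≤ z 0 ∧ z 0 ≤ x₂ ∧ y₁ ≤ z 1 ∧ z 1 ≤ y₂) ∧ ∀ e ∈ κ.edges, e ∈ C)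
    {g₁ h₁ : Site 2} (γ₁ : (zdGraph 2).Walk g₁ h₁)
    (hγ₁ : ∀ z ∈ γ₁.support, x₁ ≤ z 0 ∧ z 0 ≤ x₂ ∧ y₁ ≤ z 1 ∧ z 1 ≤ y₂)
    (hg₁ : u₁ ≤ g₁ 0 ∧ g₁ 0 ≤ u₂ ∧ g₁ 1 = y₂) (hh₁ : u₁ ≤ h₁ 0 ∧ h₁ 0 ≤ u₂ ∧ h₁ 1 = y₁)
    {g₂ h₂ : Site 2} (γ₂ : (zdGraph 2).Walk g₂ h₂)
    (hγ₂ : ∀ z ∈ γ₂.support, x₁ ≤ z 0 ∧ z 0 ≤ x₂ ∧ y₁ ≤ z 1 ∧ z 1 ≤ y₂)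
    (hg₂ : u₁ ≤ g₂ 0 ∧ g₂ 0 ≤ u₂ ∧ g₂ 1 = y₂) (hh₂ : u₁ ≤ h₂ 0 ∧ h₂ 0 ≤ u₂ ∧ h₂ 1 = y₁) :
    ∃ (F₁ F₂ : Site 2) (η : (zdGraph 2).Walk F₁ F₂), F₁ ∈ γ₁.support ∧ F₂ ∈ γ₂.support ∧
      (∀ dq ∈ η.darts, sepEdge dq.fst dq.snd ∉ C) ∧
      (∀ dq ∈ η.darts, ∀ w ∈ sepEdge dq.fst dq.snd, x₁ ≤ w 0 ∧ w 0 ≤ x₂ ∧ y₁ ≤ w 1 ∧ w 1 ≤ y₂) ∧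
      (∀ F ∈ η.support, x₁ - 1 ≤ F 0 ∧ F 0 ≤ x₂ ∧ y₁ - 1 ≤ F 1 ∧ F 1 ≤ y₂) := by
  classical
  -- the sets of the duality statement
  set Hs : Set (Site 2) := {x | x₁ ≤ x 0 ∧ x 0 ≤ x₂ ∧ y₁ ≤ x 1 ∧ x 1 ≤ y₂} with hHs
  set Tu : Set (Site 2) := {x | u₁ ≤ x 0 ∧ x 0 ≤ u₂ ∧ x 1 = y₂} with hTu
  set Tl : Set (Site 2) := {x | u₁ ≤ x 0 ∧ x 0 ≤ u₂ ∧ x 1 = y₁} with hTl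
  set EH : Set (Sym2 (Site 2)) := {e | ∀ z ∈ e, x₁ ≤ z 0 ∧ z 0 ≤ x₂ ∧ y₁ ≤ z 1 ∧ z 1 ≤ y₂} with hEH
  set Ins : Set (Site 2) := {f | x₁ ≤ f 0 ∧ f 0 ≤ x₂ - 1 ∧ y₁ ≤ f 1 ∧ f 1 ≤ y₂ - 1} with hIns
  set LG : Set (Site 2) := {f | (f 0 = x₁ - 1 ∧ y₁ - 1 ≤ f 1 ∧ f 1 ≤ y₂) ∨
    ((f 1 = y₂ ∨ f 1 = y₁ - 1) ∧ x₁ ≤ f 0 ∧ f 0 ≤ u₁ - 1)} with hLG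
  set RG : Set (Site 2) := {f | (f 0 = x₂ ∧ y₁ - 1 ≤ f 1 ∧ f 1 ≤ y₂) ∨
    ((f 1 = y₂ ∨ f 1 = y₁ - 1) ∧ u₂ ≤ f 0 ∧ f 0 ≤ x₂ - 1)} with hRG
  have hDu' := hDu x₁ x₂ y₁ y₂ u₁ u₂ hxu hu hux hy
  -- Step 1: the primal event fails for `ω := C ∩ E(H)`
  set ω : BondConfig (Site 2) := C ∩ EH with hω
  have hωE : ω ⊆ (zdGraph 2).edgeSet := fun e he => hCE he.1
  have hωEH : ω ∩ EH = ω := by rw [hω, Set.inter_assoc, Set.inter_self]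
  have hnot : ω ∉ openCrossing Hs Tu Tl := by
    rintro ⟨p, hp, q, hq, hpq⟩
    obtain ⟨κ, hκs, hκe⟩ := exists_walk_of_mem_openConnIn hωE hpq
    exact hC ⟨p, q, κ, hp, hq, hκs, fun e he => (hκe e he).1⟩
  -- Step 2: hence the dual event holds
  have hdual : dualConfig (ω ∩ EH) ∈ openCrossing (Ins ∪ LG ∪ RG) LG RG := by
    have hx := hDu' ω hωE
    rcases hx with ⟨h1, -⟩ | ⟨h2, -⟩
    · exact absurd h1 hnot
    · exact h2
  rw [hωEH] at hdual
  obtain ⟨fL, hfL, fR, hfR, hconn⟩ := hdual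
  have hdE : dualConfig ω ⊆ (zdGraph 2).edgeSet := fun e he => he.1
  obtain ⟨η₀, hη₀s, hη₀e⟩ := exists_walk_of_mem_openConnIn hdE hconn
  -- Step 3: trim — first visit to `RG`, then last visit to `LG` before it
  obtain ⟨r, η₁, hr, hη₁s, hη₁d, hη₁u⟩ := exists_prefix_first (· ∈ RG) η₀ hfR
  obtain ⟨ℓ, η₂r, hℓ, hη₂s, hη₂d, hη₂u⟩ := exists_prefix_first (· ∈ LG) η₁.reverse (by simpa using hfL)
  set η₂ : (zdGraph 2).Walk ℓ r := η₂r.reverse with hη₂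
  have hη₂supp : ∀ z ∈ η₂.support, z ∈ Ins ∨ z = ℓ ∨ z = r := by
    intro z hz
    have hz1 : z ∈ η₂r.support := by simpa [hη₂] using hz
    have hz2 : z ∈ η₁.support := by simpa using hη₂s z hz1
    have hz3 : z ∈ η₀.support := hη₁s z hz2
    have hzS := hη₀s z hz3
    rcases hzS with (hzI | hzL) | hzR
    · exact Or.inl hzI
    · exact Or.inr (Or.inl (hη₂u z hz1 hzL))
    · exact Or.inr (Or.inr (hη₁u z hz2 hzR))
  have hη₂darts : ∀ dq ∈ η₂.darts, dq ∈ η₀.darts ∨ dq.symm ∈ η₀.darts := by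
    intro dq hdq
    rw [hη₂, Walk.darts_reverse, List.mem_reverse, List.mem_map] at hdq
    obtain ⟨d', hd', rfl⟩ := hdq
    have := hη₂d d' hd'
    rw [Walk.darts_reverse, List.mem_reverse, List.mem_map] at this
    obtain ⟨d'', hd'', rfl⟩ := this
    exact Or.inl (by simpa using hη₁d d'' hd'')
  -- every dart of `η₂` crosses an edge outside `ω`
  have hcross₀ : ∀ dq ∈ η₂.darts, sepEdge dq.fst dq.snd ∉ ω := by
    intro dq hdq
    rcases hη₂darts dq hdq with h | h
    · exact sepEdge_notMem_of_dart hη₀e h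
    · have := sepEdge_notMem_of_dart hη₀e h
      rwa [Dart.symm_toProd, Prod.fst_swap, Prod.snd_swap, sepEdge_comm] at this
  -- `ℓ` and `r` are not adjacent, so every dart has an inside face
  have hℓr : ¬ (zdGraph 2).Adj ℓ r := by
    intro hadj
    rcases stepKind_of_adj hadj with ⟨h0, h1'⟩ | ⟨h0, h1'⟩ | ⟨h1', h0⟩ | ⟨h1', h0⟩ <;>
      rcases hℓ with ⟨hl0, hl1, hl2⟩ | ⟨hl0, hl1, hl2⟩ <;> rcases hr with ⟨hr0, hr1, hr2⟩ | ⟨hr0, hr1, hr2⟩ <;> omega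
  have hinside : ∀ dq ∈ η₂.darts, dq.fst ∈ Ins ∨ dq.snd ∈ Ins := by
    intro dq hdq
    have h1 := hη₂supp dq.fst (Walk.dart_fst_mem_support_of_mem_darts _ hdq)
    have h2 := hη₂supp dq.snd (Walk.dart_snd_mem_support_of_mem_darts _ hdq)
    rcases h1 with h1 | rfl | rfl
    · exact Or.inl h1
    · rcases h2 with h2 | h2 | h2
      · exact Or.inr h2
      · exact absurd h2 dq.adj.ne.symm
      · exact absurd (h2 ▸ dq.adj) hℓr
    · rcases h2 with h2 | h2 | h2
      · exact Or.inr h2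
      · exact absurd (h2 ▸ dq.adj).symm hℓr
      · exact absurd h2 dq.adj.ne.symm
  -- hence the crossed edges lie in `H`
  have hinH : ∀ dq ∈ η₂.darts, ∀ w ∈ sepEdge dq.fst dq.snd, x₁ ≤ w 0 ∧ w 0 ≤ x₂ ∧ y₁ ≤ w 1 ∧ w 1 ≤ y₂ := by
    intro dq hdq w hw
    rcases hinside dq hdq with hf | hf
    · have := sepEdge_subset_face dq.adj hw
      simp only [hIns, Set.mem_setOf_eq] at hf
      omega
    · rw [sepEdge_comm] at hw
      have := sepEdge_subset_face dq.adj.symm hw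
      simp only [hIns, Set.mem_setOf_eq] at hf
      omega
  have hcross : ∀ dq ∈ η₂.darts, sepEdge dq.fst dq.snd ∉ C := by
    intro dq hdq hmem
    exact hcross₀ dq hdq ⟨hmem, fun w hw => hinH dq hdq w hw⟩
  -- Step 4: `η₂` crosses each wall
  have hwall : ∀ {g h : Site 2} (γ : (zdGraph 2).Walk g h),
      (∀ z ∈ γ.support, x₁ ≤ z 0 ∧ z 0 ≤ x₂ ∧ y₁ ≤ z 1 ∧ z 1 ≤ y₂) →
      (u₁ ≤ g 0 ∧ g 0 ≤ u₂ ∧ g 1 = y₂) → (u₁ ≤ h 0 ∧ h 0 ≤ u₂ ∧ h 1 = y₁) →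
      ∃ dq ∈ η₂.darts, sepEdge dq.fst dq.snd ∈ γ.edges := by
    intro g h γ hγ hg hh
    by_contra hno
    push Not at hno
    set ω₁ : BondConfig (Site 2) := {e | e ∈ γ.edges} with hω₁
    have hω₁E : ω₁ ⊆ (zdGraph 2).edgeSet := fun e he => Walk.edges_subset_edgeSet γ he
    have hω₁EH : ω₁ ∩ EH = ω₁ :=
      Set.inter_eq_left.2 fun e he z hz => hγ z (mem_support_of_mem_edges' he hz)
    have hprim : ω₁ ∈ openCrossing Hs Tu Tl :=
      ⟨g, hg, h, hh, mem_openConnIn_of_walk γ (fun z hz => hγ z hz) fun e he => he⟩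
    have hdual' : dualConfig (ω₁ ∩ EH) ∈ openCrossing (Ins ∪ LG ∪ RG) LG RG := by
      rw [hω₁EH]
      refine ⟨ℓ, hℓ, r, hr, mem_openConnIn_of_walk η₂ ?_ (edges_mem_dualConfig_of_forall_sepEdge hno)⟩
      intro z hz
      rcases hη₂supp z hz with h | rfl | rfl
      · exact Or.inl (Or.inl h)
      · exact Or.inl (Or.inr hℓ)
      · exact Or.inr hr
    rcases hDu' ω₁ hω₁E with ⟨-, h2⟩ | ⟨-, h1⟩
    · exact h2 hdual'
    · exact h1 hprim
  obtain ⟨d₁, hd₁, hd₁γ⟩ := hwall γ₁ hγ₁ hg₁ hh₁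
  obtain ⟨d₂, hd₂, hd₂γ⟩ := hwall γ₂ hγ₂ hg₂ hh₂
  -- Step 5: the faces labelled by wall vertices and the face walk between them
  set F₁ := sepLo d₁.fst d₁.snd with hF₁
  set F₂ := sepLo d₂.fst d₂.snd with hF₂
  have hF₁γ : F₁ ∈ γ₁.support := mem_support_of_mem_edges' hd₁γ (sepLo_mem_sepEdge _ _)
  have hF₂γ : F₂ ∈ γ₂.support := mem_support_of_mem_edges' hd₂γ (sepLo_mem_sepEdge _ _)
  have hF₁η : F₁ ∈ η₂.support := by
    rcases sepLo_eq_or _ _ d₁.adj with h | h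
    · rw [hF₁, h]; exact Walk.dart_fst_mem_support_of_mem_darts _ hd₁
    · rw [hF₁, h]; exact Walk.dart_snd_mem_support_of_mem_darts _ hd₁
  have hF₂η : F₂ ∈ η₂.support := by
    rcases sepLo_eq_or _ _ d₂.adj with h | h
    · rw [hF₂, h]; exact Walk.dart_fst_mem_support_of_mem_darts _ hd₂
    · rw [hF₂, h]; exact Walk.dart_snd_mem_support_of_mem_darts _ hd₂
  set ρ₁ := η₂.takeUntil F₁ hF₁η with hρ₁
  set ρ₂ := η₂.takeUntil F₂ hF₂η with hρ₂
  refine ⟨F₁, F₂, ρ₁.reverse.append ρ₂, hF₁γ, hF₂γ, ?_, ?_, ?_⟩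
  · intro dq hdq
    rw [Walk.darts_append, List.mem_append, Walk.darts_reverse, List.mem_reverse, List.mem_map] at hdq
    rcases hdq with ⟨d', hd', rfl⟩ | hdq
    · have := hcross d' (Walk.darts_takeUntil_subset_darts _ _ hd')
      rwa [Dart.symm_toProd, Prod.fst_swap, Prod.snd_swap, sepEdge_comm]
    · exact hcross dq (Walk.darts_takeUntil_subset_darts _ _ hdq)
  · intro dq hdq
    rw [Walk.darts_append, List.mem_append, Walk.darts_reverse, List.mem_reverse, List.mem_map] at hdq
    rcases hdq with ⟨d', hd', rfl⟩ | hdq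
    · intro w hw
      rw [Dart.symm_toProd, Prod.fst_swap, Prod.snd_swap, sepEdge_comm] at hw
      exact hinH d' (Walk.darts_takeUntil_subset_darts _ _ hd') w hw
    · exact hinH dq (Walk.darts_takeUntil_subset_darts _ _ hdq)
  · intro F hF
    rw [Walk.support_append, List.mem_append, Walk.support_reverse, List.mem_reverse] at hF
    have hF' : F ∈ η₂.support := by
      rcases hF with hF | hF
      · exact Walk.support_takeUntil_subset_support _ _ hF
      · exact Walk.support_takeUntil_subset_support _ _ (List.tail_subset _ hF)
    rcases hη₂supp F hF' with h | rfl | rfl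
    · simp only [hIns, Set.mem_setOf_eq] at h; omega
    · rcases hℓ with ⟨h0, h1, h2⟩ | ⟨h0, h1, h2⟩ <;> omega
    · rcases hr with ⟨h0, h1, h2⟩ | ⟨h0, h1, h2⟩ <;> omega

/-! ### The winding half -/

/-- Winding of a walk is constant on the vertex set of any walk avoiding it (prefix version of
`walkWinding_eq_of_walk`). [folklore] -/
theorem walkWinding_eq_of_mem_support {a b : Site 2} (p : (zdGraph 2).Walk a b) {c d : Site 2}
    (q : (zdGraph 2).Walk c d) (hq : ∀ z ∈ q.support, z ∉ p.support)
    (ha : ∀ z ∈ q.support, a ∉ rayAbove z) (hb : ∀ z ∈ q.support, b ∉ rayAbove z)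
    {z : Site 2} (hz : z ∈ q.support) : walkWinding p c = walkWinding p z := by
  classical
  have hs : ∀ w ∈ (q.takeUntil z hz).support, w ∈ q.support :=
    fun w hw => Walk.support_takeUntil_subset_support _ _ hw
  exact walkWinding_eq_of_walk p (q.takeUntil z hz) (fun w hw => hq w (hs w hw))
    (fun w hw => ha w (hs w hw)) fun w hw => hb w (hs w hw)

/-- **The winding contradiction behind the corridor lemma** (discrete form of the topological
step in [KohlerSchindlerTassion2023, Lemma 2]; Kesten 1982, §2.2): in the box
`[L, R] × [B₀, T₀]` let `χ` be a walk from the left column to the right column, and consider a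
chain top row ∋ `dt` ~ `ζt` ~ `ct ∈ γt ∋ Ft` ~ face walk `η` ~ `Fb ∈ γb ∋ cb` ~ `ζb` ~ `db` ∈
bottom row of lattice walks avoiding `χ` and a face walk crossing no edge of `χ` (faces indexed by
lower-left corners, so a face label may coincide with a wall vertex). This is impossible: the
winding number of `χ`, prolonged one step to the left and extended right and down
(`extendRight`), is constant along the chain but `0` at the top and `-1` below the bottom.
[cite: KohlerSchindlerTassion2023, Lemma 2] -/
theorem corridor_chain_false {L R B₀ T₀ : ℤ} {a b : Site 2} (χ : (zdGraph 2).Walk a b)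
    (hχ : ∀ z ∈ χ.support, L ≤ z 0 ∧ z 0 ≤ R ∧ B₀ ≤ z 1 ∧ z 1 ≤ T₀) (ha : a 0 = L) (hb : b 0 = R)
    {ct dt : Site 2} (ζt : (zdGraph 2).Walk ct dt)
    (hζt : ∀ z ∈ ζt.support, (L ≤ z 0 ∧ z 0 ≤ R ∧ B₀ ≤ z 1) ∧ z ∉ χ.support) (hdt : dt 1 = T₀)
    {gt kt : Site 2} (γt : (zdGraph 2).Walk gt kt)
    (hγt : ∀ z ∈ γt.support, (L ≤ z 0 ∧ z 0 ≤ R ∧ B₀ ≤ z 1) ∧ z ∉ χ.support)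
    (hct : ct ∈ γt.support) {Ft Fb : Site 2} (hFt : Ft ∈ γt.support)
    (η : (zdGraph 2).Walk Ft Fb) (hηC : ∀ dq ∈ η.darts, sepEdge dq.fst dq.snd ∉ χ.edges)
    (hηH : ∀ dq ∈ η.darts, ∀ w ∈ sepEdge dq.fst dq.snd, L ≤ w 0 ∧ w 0 ≤ R)
    (hηS : ∀ F ∈ η.support, L - 1 ≤ F 0 ∧ B₀ - 1 ≤ F 1)
    {gb kb : Site 2} (γb : (zdGraph 2).Walk gb kb)
    (hγb : ∀ z ∈ γb.support, (L ≤ z 0 ∧ z 0 ≤ R ∧ B₀ ≤ z 1) ∧ z ∉ χ.support)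
    (hFb : Fb ∈ γb.support) {cb db : Site 2} (hcb : cb ∈ γb.support) (ζb : (zdGraph 2).Walk cb db)
    (hζb : ∀ z ∈ ζb.support, (L ≤ z 0 ∧ z 0 ≤ R ∧ B₀ ≤ z 1) ∧ z ∉ χ.support) (hdb : db 1 = B₀) :
    False := by
  classical
  -- the crosser prolonged one step to the left, then extended right and down
  set a' : Site 2 := a - Pi.single 0 1 with ha'
  have hadj : (zdGraph 2).Adj a' a := adj_of_stepKind (.right (by simp [ha']) (by simp [ha']))
  set χ' : (zdGraph 2).Walk a' b := Walk.cons hadj χ with hχ'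
  have hχ'supp : ∀ z ∈ χ'.support, z = a' ∨ z ∈ χ.support := by
    intro z hz
    rw [hχ', Walk.support_cons, List.mem_cons] at hz
    exact hz
  have hχ'rows : ∀ z ∈ χ'.support, B₀ ≤ z 1 ∧ z 1 ≤ T₀ := by
    intro z hz
    rcases hχ'supp z hz with rfl | hz
    · have := hχ a χ.start_mem_support
      simp [ha']; omega
    · exact ⟨(hχ z hz).2.2.1, (hχ z hz).2.2.2⟩
  have hBb : B₀ ≤ b 1 := (hχ b χ.end_mem_support).2.2.1
  set P := extendRight χ' B₀ with hP
  -- the chain avoids `P`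
  have havoidP : ∀ z : Site 2, (L ≤ z 0 ∧ z 0 ≤ R ∧ B₀ ≤ z 1) ∧ z ∉ χ.support → z ∉ P.support := by
    rintro z ⟨⟨hzL, hzR, -⟩, hzχ⟩ hzP
    rcases mem_support_extendRight hBb hzP with hz | hz
    · rcases hχ'supp z hz with rfl | hz
      · simp [ha'] at hzL; omega
      · exact hzχ hz
    · omega
  have hrayA : ∀ z : Site 2, L - 1 ≤ z 0 → a' ∉ rayAbove z := by
    intro z hz hmem
    rw [mem_rayAbove] at hmem
    simp [ha'] at hmem
    omega
  have hrayB : ∀ z : Site 2, B₀ - 1 ≤ z 1 →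
      ((fun w : Site 2 => w - Pi.single 1 1)^[(b 1 - B₀).toNat + 2] (b + Pi.single 0 1)) ∉
        rayAbove z := by
    intro z hz hmem
    rw [mem_rayAbove, (extendRight_end_apply b hBb).2] at hmem
    omega
  -- constancy along a lattice walk of the chain
  have hconst : ∀ {c d : Site 2} (q : (zdGraph 2).Walk c d),
      (∀ z ∈ q.support, (L ≤ z 0 ∧ z 0 ≤ R ∧ B₀ ≤ z 1) ∧ z ∉ χ.support) →
      ∀ z ∈ q.support, walkWinding P c = walkWinding P z := by
    intro c d q hq z hz
    exact walkWinding_eq_of_mem_support P q (fun w hw => havoidP w (hq w hw))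
      (fun w hw => hrayA w (by have := (hq w hw).1.1; omega))
      (fun w hw => hrayB w (by have := (hq w hw).1.2.2; omega)) hz
  -- winding at the top end of `ζt` and below the bottom end of `ζb`
  have hw_top : walkWinding P dt = 0 := walkWinding_extendRight_top hχ'rows hdt
  set u : Site 2 := db - Pi.single 1 1 with hu'
  have hdbT := hζb db ζb.end_mem_support
  have hw_bot : walkWinding P u = -1 :=
    walkWinding_extendRight_bottom hχ'rows (by simp [hu', hdb]) (by
      have := hdbT.1.2.1; simp [hu', hb]; omega)
  -- along `ζt`, `γt`
  have h1 : walkWinding P ct = walkWinding P dt := hconst ζt hζt dt ζt.end_mem_support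
  have h2 : walkWinding P ct = walkWinding P Ft :=
    (hconst γt hγt ct hct).symm.trans (hconst γt hγt Ft hFt)
  -- along the face walk
  have h3 : walkWinding P Ft = walkWinding P Fb := by
    refine walkWinding_eq_of_faceWalk P η ?_ ?_ ?_
    · intro dq hdq hmem
      rcases mem_edges_extendRight hmem with he | ⟨w, hw, hw0⟩
      · rw [hχ', Walk.edges_cons, List.mem_cons] at he
        rcases he with he | he
        · -- the prolonging edge has an endpoint in the column `L - 1`
          have hmemA : a' ∈ sepEdge dq.fst dq.snd := by rw [he]; exact Sym2.mem_mk_left _ _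
          have := hηH dq hdq a' hmemA
          simp [ha'] at this; omega
        · exact hηC dq hdq he
      · have := hηH dq hdq w hw
        omega
    · intro F hF; exact hrayA F (hηS F hF).1
    · intro F hF; exact hrayB F (hηS F hF).2
  -- along `γb`, `ζb`
  have h4 : walkWinding P Fb = walkWinding P cb :=
    (hconst γb hγb Fb hFb).symm.trans (hconst γb hγb cb hcb)
  have h5 : walkWinding P cb = walkWinding P db := hconst ζb hζb db ζb.end_mem_support
  -- the last step down from `db` to `u`
  have h6 : walkWinding P db = walkWinding P u := by
    refine walkWinding_eq_of_walk P (Walk.cons (adj_sub_single_one db) Walk.nil) ?_ ?_ ?_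
    · intro z hz
      simp only [Walk.support_cons, Walk.support_nil, List.mem_cons, List.not_mem_nil,
        or_false] at hz
      rcases hz with rfl | rfl
      · exact havoidP _ hdbT
      · intro hzP
        rcases mem_support_extendRight hBb hzP with hz | hz
        · rcases hχ'supp _ hz with h | h
          · have := congr_fun h 0
            have h' := hdbT.1.1
            simp [ha'] at this; omega
          · have := (hχ _ h).2.2.1; simp at this; omega
        · have h' := hdbT.1.2.1
          simp [hb] at hz; omega
    · intro z hz
      simp only [Walk.support_cons, Walk.support_nil, List.mem_cons, List.not_mem_nil,
        or_false] at hz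
      rcases hz with rfl | rfl
      · exact hrayA _ (by have := hdbT.1.1; omega)
      · exact hrayA _ (by have := hdbT.1.1; simp; omega)
    · intro z hz
      simp only [Walk.support_cons, Walk.support_nil, List.mem_cons, List.not_mem_nil,
        or_false] at hz
      rcases hz with rfl | rfl
      · exact hrayB _ (by have := hdbT.1.2.2; omega)
      · exact hrayB _ (by simp [hdb])
  -- contradiction
  have : (0 : ℤ) = -1 := by rw [← hw_top, ← h1, h2, h3, h4, h5, h6, hw_bot]
  omega

/-- **Corridor lemma, horizontal crosser, from the arm duality** ([KohlerSchindlerTassion2023,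
Lemma 2 with Remark 1]): see `CorridorA`. The face walk of `corridor_faceWalk` joins the two
walls, and `corridor_chain_false` applies to the chain top row ~ `ζ₁` ~ `γ₁` ~ faces ~ `γ₂` ~
`ζ₂` ~ bottom row. [cite: KohlerSchindlerTassion2023, Lemma 2 and Remark 1] -/
theorem corridorA_of_armDuality (hDu : ArmDuality) : CorridorA := by
  intro L R B₀ T₀ x₁ x₂ y₁ y₂ u₁ u₂ hLx hxR hBy _hyT hxu hu hux hy a b χ hχ ha hb
    g₁ h₁ γ₁ hγ₁ hg₁ hh₁ c₁ d₁ ζ₁ hζ₁ hc₁ hd₁ g₂ h₂ γ₂ hγ₂ hg₂ hh₂ c₂ d₂ ζ₂ hζ₂ hc₂ hd₂ havoid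
  classical
  by_contra hno
  have hCE : {e | e ∈ χ.edges} ⊆ (zdGraph 2).edgeSet := fun e he => Walk.edges_subset_edgeSet χ he
  obtain ⟨F₁, F₂, η, hF₁, hF₂, hηC, hηH, hηS⟩ :=
    corridor_faceWalk hDu hxu hu hux hy hCE (by simpa using hno) γ₁ hγ₁ hg₁ hh₁ γ₂ hγ₂ hg₂ hh₂
  have hH : ∀ z : Site 2, x₁ ≤ z 0 ∧ z 0 ≤ x₂ ∧ y₁ ≤ z 1 ∧ z 1 ≤ y₂ →
      L ≤ z 0 ∧ z 0 ≤ R ∧ B₀ ≤ z 1 := fun z hz => ⟨hLx.trans hz.1, hz.2.1.trans hxR, hBy.trans hz.2.2.1⟩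
  exact corridor_chain_false χ hχ ha hb ζ₁
    (fun z hz => ⟨⟨(hζ₁ z hz).1, (hζ₁ z hz).2.1, (hζ₁ z hz).2.2.1⟩, fun h => (havoid z h).2.1 hz⟩)
    hd₁ γ₁ (fun z hz => ⟨hH z (hγ₁ z hz), fun h => (havoid z h).1 hz⟩) hc₁ hF₁ η hηC
    (fun dq hdq w hw => ⟨hLx.trans (hηH dq hdq w hw).1, (hηH dq hdq w hw).2.1.trans hxR⟩)
    (fun F hF => ⟨by have := (hηS F hF).1; omega, by have := (hηS F hF).2.2.1; omega⟩)
    γ₂ (fun z hz => ⟨hH z (hγ₂ z hz), fun h => (havoid z h).2.2.1 hz⟩) hF₂ hc₂ ζ₂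
    (fun z hz => ⟨⟨(hζ₂ z hz).1, (hζ₂ z hz).2.1, (hζ₂ z hz).2.2.1⟩, fun h => (havoid z h).2.2.2 hz⟩)
    hd₂

/-! ### The vertical crosser: transposition -/

/-- Vertices of a transposed walk. [folklore] -/
theorem mem_support_map_transposeIso {x y : Site 2} (p : (zdGraph 2).Walk x y) {z : Site 2} :
    z ∈ (p.map transposeIso.toEmbedding.toHom).support ↔ transposeIso z ∈ p.support := by
  rw [Walk.support_map, List.mem_map]
  constructor
  · rintro ⟨w, hw, rfl⟩
    have : transposeIso (transposeIso w) = w := by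
      rw [LatticeModels.Site.eq_iff_two]; simp
    show transposeIso (transposeIso w) ∈ p.support
    rwa [this]
  · intro h
    refine ⟨transposeIso z, h, ?_⟩
    show transposeIso (transposeIso z) = z
    rw [LatticeModels.Site.eq_iff_two]; simp

/-- Edges of a transposed walk. [folklore] -/
theorem mem_edges_map_transposeIso {x y : Site 2} (p : (zdGraph 2).Walk x y) {e : Sym2 (Site 2)} :
    Sym2.map transposeIso e ∈ (p.map transposeIso.toEmbedding.toHom).edges ↔ e ∈ p.edges := by
  rw [Walk.edges_map, List.mem_map]
  have hinj : Function.Injective (Sym2.map transposeIso) := Sym2.map.injective transposeIso.injective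
  constructor
  · rintro ⟨e', he', hee⟩
    have : e' = e := hinj hee
    exact this ▸ he'
  · intro h; exact ⟨e, h, rfl⟩

/-- **Corridor lemma, vertical crosser, from the arm duality** ([KohlerSchindlerTassion2023,
Lemma 2]): see `CorridorB`. Transposing the configuration (`transposeIso`; the face walk of
`corridor_faceWalk` transposes to a face walk by `sepEdge_transposeIso`) turns the vertical
crosser into a horizontal one and the chain left column ~ `ζ₁` ~ `γ₁` ~ faces ~ `γ₂` ~ `ζ₂` ~
right column into a bottom-to-top chain, and `corridor_chain_false` applies.
[cite: KohlerSchindlerTassion2023, Lemma 2] -/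
theorem corridorB_of_armDuality (hDu : ArmDuality) : CorridorB := by
  intro L R B₀ T₀ x₁ x₂ y₁ y₂ u₁ u₂ hLx hxR hBy hyT hxu hu hux hy a b π hπ ha hb
    g₁ h₁ γ₁ hγ₁ hg₁ hh₁ c₁ d₁ ζ₁ hζ₁ hc₁ hd₁ g₂ h₂ γ₂ hγ₂ hg₂ hh₂ c₂ d₂ ζ₂ hζ₂ hc₂ hd₂ havoid
  classical
  by_contra hno
  have hCE : {e | e ∈ π.edges} ⊆ (zdGraph 2).edgeSet := fun e he => Walk.edges_subset_edgeSet π he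
  -- the face walk from the right wall `γ₂` to the left wall `γ₁`
  obtain ⟨F₂, F₁, η, hF₂, hF₁, hηC, hηH, hηS⟩ :=
    corridor_faceWalk hDu hxu hu hux hy hCE (by simpa using hno) γ₂ hγ₂ hg₂ hh₂ γ₁ hγ₁ hg₁ hh₁
  -- transpose everything
  set T := transposeIso.toEmbedding.toHom with hT
  have hTapply : ∀ x : Site 2, T x = transposeIso x := fun x => rfl
  have hTT : ∀ x : Site 2, transposeIso (transposeIso x) = x := fun x => by
    rw [LatticeModels.Site.eq_iff_two]; simp
  have hH : ∀ z : Site 2, x₁ ≤ z 0 ∧ z 0 ≤ x₂ ∧ y₁ ≤ z 1 ∧ z 1 ≤ y₂ →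
      L ≤ z 0 ∧ z 0 ≤ R ∧ B₀ ≤ z 1 := fun z hz => ⟨hLx.trans hz.1, hz.2.1.trans hxR, hBy.trans hz.2.2.1⟩
  -- the transposed crosser, from the column `B₀` to the column `T₀` of `[B₀, T₀] × [L, R]`
  set χ : (zdGraph 2).Walk (transposeIso b) (transposeIso a) := (π.map T).reverse with hχdef
  have hχsupp : ∀ z : Site 2, z ∈ χ.support ↔ transposeIso z ∈ π.support := by
    intro z; rw [hχdef, Walk.support_reverse, List.mem_reverse]; exact mem_support_map_transposeIso π
  have hχedges : ∀ e : Sym2 (Site 2), Sym2.map transposeIso e ∈ χ.edges ↔ e ∈ π.edges := by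
    intro e; rw [hχdef, Walk.edges_reverse, List.mem_reverse]; exact mem_edges_map_transposeIso π
  have hχ : ∀ z ∈ χ.support, B₀ ≤ z 0 ∧ z 0 ≤ T₀ ∧ L ≤ z 1 ∧ z 1 ≤ R := by
    intro z hz
    have := hπ _ ((hχsupp z).1 hz)
    simp only [transposeIso_apply_zero, transposeIso_apply_one] at this
    omega
  -- transport of the side conditions of a chain walk
  have hside : ∀ {x y : Site 2} (q : (zdGraph 2).Walk x y),
      (∀ z ∈ q.support, (L ≤ z 0 ∧ z 0 ≤ R ∧ B₀ ≤ z 1 ∧ z 1 ≤ T₀) ∧ z ∉ π.support) →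
      ∀ z ∈ (q.map T).support, (B₀ ≤ z 0 ∧ z 0 ≤ T₀ ∧ L ≤ z 1) ∧ z ∉ χ.support := by
    intro x y q hq z hz
    rw [mem_support_map_transposeIso] at hz
    have h := hq _ hz
    simp only [transposeIso_apply_zero, transposeIso_apply_one] at h
    refine ⟨⟨h.1.2.2.1, h.1.2.2.2, h.1.1⟩, fun h' => h.2 ((hχsupp z).1 h')⟩
  have hmemT : ∀ {x y : Site 2} (q : (zdGraph 2).Walk x y) {z : Site 2},
      z ∈ q.support → transposeIso z ∈ (q.map T).support := by
    intro x y q z hz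
    rw [mem_support_map_transposeIso, hTT]; exact hz
  refine corridor_chain_false (L := B₀) (R := T₀) (B₀ := L) (T₀ := R) χ hχ
    (by rw [transposeIso_apply_zero, hb]) (by rw [transposeIso_apply_zero, ha])
    (ζ₂.map T) (hside ζ₂ fun z hz => ⟨hζ₂ z hz, fun h => (havoid z h).2.2.2 hz⟩)
    (by show transposeIso d₂ 1 = R; rw [transposeIso_apply_one, hd₂])
    (γ₂.map T) (hside γ₂ fun z hz => ⟨⟨(hH z (hγ₂ z hz)).1, (hH z (hγ₂ z hz)).2.1,
      (hH z (hγ₂ z hz)).2.2, (hγ₂ z hz).2.2.2.trans hyT⟩, fun h => (havoid z h).2.2.1 hz⟩)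
    (hmemT γ₂ hc₂) (hmemT γ₂ hF₂) (η.map T) ?_ ?_ ?_
    (γ₁.map T) (hside γ₁ fun z hz => ⟨⟨(hH z (hγ₁ z hz)).1, (hH z (hγ₁ z hz)).2.1,
      (hH z (hγ₁ z hz)).2.2, (hγ₁ z hz).2.2.2.trans hyT⟩, fun h => (havoid z h).1 hz⟩)
    (hmemT γ₁ hF₁) (hmemT γ₁ hc₁) (ζ₁.map T)
    (hside ζ₁ fun z hz => ⟨hζ₁ z hz, fun h => (havoid z h).2.1 hz⟩)
    (by show transposeIso d₁ 1 = L; rw [transposeIso_apply_one, hd₁])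
  · -- the transposed face walk crosses no edge of the transposed crosser
    intro dq hdq hmem
    rw [Walk.darts_map, List.mem_map] at hdq
    obtain ⟨d, hd, rfl⟩ := hdq
    have h1 : sepEdge (T.mapDart d).toProd.1 (T.mapDart d).toProd.2 =
        Sym2.map transposeIso (sepEdge d.fst d.snd) := sepEdge_transposeIso d.adj
    rw [h1, hχedges] at hmem
    exact hηC d hd hmem
  · intro dq hdq w hw
    rw [Walk.darts_map, List.mem_map] at hdq
    obtain ⟨d, hd, rfl⟩ := hdq
    have h1 : sepEdge (T.mapDart d).toProd.1 (T.mapDart d).toProd.2 =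
        Sym2.map transposeIso (sepEdge d.fst d.snd) := sepEdge_transposeIso d.adj
    rw [h1, Sym2.mem_map] at hw
    obtain ⟨w', hw', rfl⟩ := hw
    have := hηH d hd w' hw'
    simp only [transposeIso_apply_zero]
    omega
  · intro F hF
    rw [mem_support_map_transposeIso] at hF
    have := hηS _ hF
    simp only [transposeIso_apply_zero, transposeIso_apply_one] at this
    omega

end KSTPeriodic

end

end Literature.Probability.Percolation
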